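import Summits.Ventures.DiscreteObjects.Hadamard.PaleyLP167
import Summits.Ventures.DiscreteObjects.Hadamard.PlugIns668
import Summits.Ventures.DiscreteObjects.Hadamard.Order167Normalizer668
import Summits.Ventures.DiscreteObjects.Hadamard.NormalizerOrbitTools

/-!
# H(668) census, row F8: the D-OPTIMAL ROUTE (a D-optimal design of order 334 + two Paley blocks ⇒ H(668)) in the
# kernel, its grammar, and the multiplier-symmetric sub-family decided EMPTY

Framing: lottery ticket; floor = certified bounds/negative ranges.  Cell pub-namedobj (venture DiscreteObjects),
target (H), hadamard gen 27.  TABLE-H row F8 had no kernel column of its own.  A D-OPTIMAL PAIR of (odd) length `v` is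
a pair of `±1` sequences `c, d : ZMod v → ℤ` with `PAF_c(s) + PAF_d(s) = 2` for every `s ≠ 0`, i.e. two circulants with
`C Cᵀ + D Dᵀ = (2v − 2) I + 2 J` — the two-circulant form of a D-optimal design (maximal-determinant `±1` matrix) of
order `2v ≡ 2 (mod 4)` (Ehlich 1964; Seberry–Yamada 2020, Def. 12.5 / Remark 12.2; as supplementary difference sets
`2-{v; k₁, k₂; λ}`, `λ = k₁ + k₂ − (v − 1)/2`: Đoković–Kotsireas, J. Combin. Des. 2012, whose table lists
`(167; 76, 73; 66)` as OPEN).  For a prime `v ≡ 3 (mod 4)` the Paley-type block `q = χ'` (`1` at `0`, the Legendre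
symbol elsewhere; here gen 2's `paley167`) has `PAF_q(s) = −1` (`s ≠ 0`), so `(q, q, c, d)` is a Goethals–Seidel
quadruple and gives `H(4v)`; with symmetric `d` this is Balonin–Seberry's propus family (Seberry–Yamada 2020,
§9.10.1 (iii)), in the Goethals–Seidel array no symmetry is needed.  This file proves, with no `sorry`:
* §1 grammar: `dOptPair_rowsum_sq` (`(Σc)² + (Σd)² = 4v − 2`, any `v`), **`dOptPair167_rowsums`**
  (`{|Σc|, |Σd|} = {15, 21}`: `666 = 15² + 21²` uniquely; this is the parameter set `(167; 76, 73; 66)`).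
* §2 plug-in: `gsQuad_of_dOptPair167` (`(χ', χ', c, d)` is a `GSQuad` over `ZMod 167`), **`hadamard668_of_dOptPair167`**
  (a D-optimal pair of length `167` — equivalently a two-circulant D-optimal design of order `334` — gives `H(668)`);
  `(+)` CONTROL `hadamard28_of_dOptPair7` (`v = 7`: `(χ₇', χ₇', χ₇', J − 2δ₀)` ⇒ `H(28)`, conditions by kernel evaluation).
* §3 **census (negative line): the D-optimal pair of length `167` admits NO signed / swapped / shifted multiplier
  symmetry `x_{πk}(h t + s_k) = ε_k x_k(t)` with `h² ≠ 1`** (`dOptPair167_no_pairSymmetry`; `π ∈ Sym({c,d})`, signs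
  `ε_k`, independent shifts `s_k`, `h = 0` included), in particular no common multiplier group of order `83` or `166`
  (`dOptPair167_no_multiplier`).  Proof: iterating the symmetry twice removes `π`, twice more removes the sign, so each
  row is affine-invariant under `h⁴`, `(h⁴)² ≠ 1`; by gen 20's recentring (`exists_translate_hInvariant_prime`,
  `inv4_of_hInvariant`) each row has a square-invariant translate; translates keep the PAF condition, `χ'` is
  square-invariant, so `(χ', χ', c', d')` would be a square-invariant GS quadruple — excluded by gen 2's kernel
  certificate `no_gs_quad_qr167` (bound line 1).  `h = ±1` (in particular the symmetric 'D-optimal propus' shape) is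
  the open, unstructured residue (`2^{166}` per row).
WORDS: plug-in + negative symmetry line about a hypothetical object (the D-optimal design of order `334` is itself an
open named object); no order excluded; `H(668)` untouched.  Ours; no `sorry`.
-/

namespace Summit.Ventures.DiscreteObjects.Hadamard

open Finset BigOperators Matrix

open Literature.Combinatorics.Designs.GoethalsSeidel (IsHadamardMatrix gsMatrix goethalsSeidel_isHadamard)
open Literature.Combinatorics.Designs.LegendrePairs (PAF IsPM HInvariant TwistedInvariant translate PAF_translate
  sq_rowsum paf_zero)

/-! ## §1 Grammar: row sums of a D-optimal pair -/

section grammar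
variable {n : ℕ} [NeZero n]

/-- `(Σc)² + (Σd)² = 4n − 2` for a D-optimal pair of length `n` (PSD at frequency `0`; Ehlich's two-squares form). -/
theorem dOptPair_rowsum_sq (c d : ZMod n → ℤ) (hc : IsPM c) (hd : IsPM d)
    (hcd : ∀ s : ZMod n, s ≠ 0 → PAF c s + PAF d s = 2) :
    (∑ i, c i) ^ 2 + (∑ i, d i) ^ 2 = 4 * n - 2 := by
  rw [sq_rowsum, sq_rowsum, ← Finset.sum_add_distrib]
  have key : ∀ s : ZMod n, PAF c s + PAF d s = (if s = 0 then 2 * (n : ℤ) - 2 else 0) + 2 := by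
    intro s; split_ifs with h0
    · rw [h0, paf_zero c hc, paf_zero d hd]; ring
    · rw [hcd s h0]; ring
  rw [Finset.sum_congr rfl (fun s _ => key s), Finset.sum_add_distrib, Finset.sum_ite_eq' Finset.univ (0 : ZMod n),
    Finset.sum_const, Finset.card_univ, ZMod.card]
  simp; ring

/-- `x² + y² = 666` in integers forces `{|x|, |y|} = {15, 21}`. -/
lemma sq_add_sq_eq_666 {x y : ℤ} (h : x ^ 2 + y ^ 2 = 666) :
    (x.natAbs = 15 ∧ y.natAbs = 21) ∨ (x.natAbs = 21 ∧ y.natAbs = 15) := by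
  have hpq : (x.natAbs : ℤ) ^ 2 + (y.natAbs : ℤ) ^ 2 = 666 := by rw [Int.natAbs_pow_two, Int.natAbs_pow_two]; exact h
  set p := x.natAbs; set q := y.natAbs
  have hpq' : p ^ 2 + q ^ 2 = 666 := by exact_mod_cast hpq
  have hp : p ≤ 25 := by nlinarith
  have hq : q ≤ 25 := by nlinarith
  interval_cases p <;> interval_cases q <;> omega

/-- **Grammar at `v = 167`: a D-optimal pair of length `167` has row sums `{|Σc|, |Σd|} = {15, 21}`** — the parameter
set `2-{167; 76, 73; 66}` of the supplementary-difference-set formulation (`k = (167 − Σ)/2`). -/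
theorem dOptPair167_rowsums (c d : ZMod 167 → ℤ) (hc : IsPM c) (hd : IsPM d)
    (hcd : ∀ s : ZMod 167, s ≠ 0 → PAF c s + PAF d s = 2) :
    ((∑ i, c i).natAbs = 15 ∧ (∑ i, d i).natAbs = 21) ∨ ((∑ i, c i).natAbs = 21 ∧ (∑ i, d i).natAbs = 15) := by
  have h := dOptPair_rowsum_sq c d hc hd hcd
  norm_num at h
  exact sq_add_sq_eq_666 h

end grammar

/-! ## §2 The plug-in: two Paley blocks and a D-optimal pair form a Goethals–Seidel quadruple -/

/-- `PAF_{χ'}(s) = −1` for `s ≠ 0` (from gen 2's kernel evaluation `paley167_paf`). -/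
lemma paley167_paf_eq (s : ZMod 167) (hs : s ≠ 0) : PAF paley167 s = -1 := by
  have h := paley167_paf s hs; omega

/-- **`(χ', χ', c, d)` is a Goethals–Seidel quadruple over `ZMod 167` for every D-optimal pair `(c, d)` of length `167`.** -/
theorem gsQuad_of_dOptPair167 (c d : ZMod 167 → ℤ) (hc : IsPM c) (hd : IsPM d)
    (hcd : ∀ s : ZMod 167, s ≠ 0 → PAF c s + PAF d s = 2) : GSQuad paley167 paley167 c d := by
  refine ⟨isPM_paley167, isPM_paley167, hc, hd, fun s hs => ?_⟩
  rw [paley167_paf_eq s hs, add_assoc, hcd s hs]; norm_num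

/-- **Row F8, HIT protocol: a D-optimal pair of length `167` (a two-circulant D-optimal design of order `334`) gives a
Hadamard matrix of order `668`** through the Goethals–Seidel array with blocks `(χ', χ', C, D)`. -/
theorem hadamard668_of_dOptPair167 (c d : ZMod 167 → ℤ) (hc : IsPM c) (hd : IsPM d)
    (hcd : ∀ s : ZMod 167, s ≠ 0 → PAF c s + PAF d s = 2) :
    IsHadamardMatrix (gsMatrix paley167 paley167 c d) ∧ Fintype.card (Fin 4 × ZMod 167) = 668 :=
  hadamard668_of_gsQuad _ _ _ _ (gsQuad_of_dOptPair167 c d hc hd hcd)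

/-- **(+) control of the F8 pipeline at `v = 7`**: `c = χ₇' = (1,1,1,−1,1,−1,−1)` and `d = J − 2δ₀` form a D-optimal
pair of length `7` (`PAF_c + PAF_d = −1 + 3 = 2`), `(χ₇', χ₇', c, d)` is a GS quadruple (kernel evaluation), and the
Goethals–Seidel array gives a Hadamard matrix of order `28`. -/
theorem hadamard28_of_dOptPair7 :
    ∃ q c d : ZMod 7 → ℤ, IsPM c ∧ IsPM d ∧ (∀ s : ZMod 7, s ≠ 0 → PAF c s + PAF d s = 2) ∧
      (∀ s : ZMod 7, s ≠ 0 → PAF q s = -1) ∧ IsHadamardMatrix (gsMatrix q q c d) ∧ Fintype.card (Fin 4 × ZMod 7) = 28 := by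
  have hq : IsPM (fun i : ZMod 7 => if i = 3 ∨ i = 5 ∨ i = 6 then (-1 : ℤ) else 1) := by unfold IsPM; decide
  have hd : IsPM (fun i : ZMod 7 => if i = 0 then (-1 : ℤ) else 1) := by unfold IsPM; decide
  refine ⟨fun i => if i = 3 ∨ i = 5 ∨ i = 6 then -1 else 1, fun i => if i = 3 ∨ i = 5 ∨ i = 6 then -1 else 1,
    fun i => if i = 0 then -1 else 1, hq, hd, by decide, by decide, goethalsSeidel_isHadamard _ _ _ _ hq hq hq hd (by decide),
    by simp [ZMod.card]⟩

/-! ## §3 Census: no signed / swapped / shifted multiplier symmetry with `h² ≠ 1` -/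

section census

/-- every permutation of `Fin 2` is an involution. -/
lemma perm_fin2_apply_self : ∀ (π : Equiv.Perm (Fin 2)) (k : Fin 2), π (π k) = k := by decide

/-- **two iterations of a pair symmetry**: `x_{πk}(h t + s_k) = ε_k x_k(t)` (`k ∈ Fin 2`) gives
`x_k(h² t + (h s_k + s_{πk})) = (ε_{πk} ε_k) x_k(t)`. -/
lemma pairSymmetry_iterate2 {n : ℕ} {x : Fin 2 → ZMod n → ℤ} {h : ZMod n} {s : Fin 2 → ZMod n}
    {π : Equiv.Perm (Fin 2)} {ε : Fin 2 → ℤ} (hrel : ∀ k t, x (π k) (h * t + s k) = ε k * x k t) (k : Fin 2)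
    (t : ZMod n) : x k (h ^ 2 * t + (h * s k + s (π k))) = (ε (π k) * ε k) * x k t := by
  have e : h ^ 2 * t + (h * s k + s (π k)) = h * (h * t + s k) + s (π k) := by ring
  have e1 := hrel (π k) (h * t + s k)
  rw [perm_fin2_apply_self, hrel k t] at e1
  rw [e, e1, mul_assoc]

/-- **four iterations remove permutation and signs**: each row is affine-invariant under `h⁴`. -/
lemma pairSymmetry_iterate4 {n : ℕ} {x : Fin 2 → ZMod n → ℤ} {h : ZMod n} {s : Fin 2 → ZMod n}
    {π : Equiv.Perm (Fin 2)} {ε : Fin 2 → ℤ} (hε : ∀ k, ε k = 1 ∨ ε k = -1)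
    (hrel : ∀ k t, x (π k) (h * t + s k) = ε k * x k t) (k : Fin 2) :
    ∃ D : ZMod n, ∀ t, x k (h ^ 4 * t + D) = x k t := by
  set S : ZMod n := h * s k + s (π k) with hS
  refine ⟨h ^ 2 * S + S, fun t => ?_⟩
  have e : h ^ 4 * t + (h ^ 2 * S + S) = h ^ 2 * (h ^ 2 * t + S) + S := by ring
  rw [e, pairSymmetry_iterate2 hrel, pairSymmetry_iterate2 hrel, ← mul_assoc]
  have h1 : ε (π k) * ε k * (ε (π k) * ε k) = 1 := by
    rcases hε (π k) with a | a <;> rcases hε k with b | b <;> rw [a, b] <;> norm_num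
  rw [h1, one_mul]

/-- an affine-invariant sequence (`x (u i + d) = x i`) is translation-twisted `u`-invariant. -/
private lemma twistedInvariant_of_affineD {n : ℕ} [NeZero n] (x : ZMod n → ℤ) (u : (ZMod n)ˣ) (d : ZMod n)
    (h : ∀ i, x ((u : ZMod n) * i + d) = x i) : TwistedInvariant x u := by
  refine ⟨-(((u⁻¹ : (ZMod n)ˣ) : ZMod n) * d), fun i => ?_⟩
  have e := h (i + -(((u⁻¹ : (ZMod n)ˣ) : ZMod n) * d))
  rw [mul_add, mul_neg, ← mul_assoc, Units.mul_inv, one_mul, neg_add_cancel_right] at e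
  exact e

/-- in `ZMod 167`: `h ≠ 0`, `h² ≠ 1` ⇒ `(h⁴)² ≠ 1` (`gcd(8, 166) = 2`). -/
private lemma pow_four_sq_ne_one_167 {h : ZMod 167} (h0 : h ≠ 0) (hsq : h ^ 2 ≠ 1) : (h ^ 4) ^ 2 ≠ 1 := by
  haveI : Fact (Nat.Prime 167) := ⟨by norm_num⟩
  intro h1
  have hF : h ^ 166 = 1 := by simpa using ZMod.pow_card_sub_one_eq_one h0
  rw [← pow_mul] at h1
  have h2 : h ^ Nat.gcd (4 * 2) 166 = 1 := pow_gcd_eq_one.2 ⟨h1, hF⟩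
  rw [show Nat.gcd (4 * 2) 166 = 2 by decide] at h2
  exact hsq h2

/-- **a square-invariant translate from an affine symmetry with `u² ≠ 1`, `u ≠ 0`** (private copy of the tool of
`ConferenceRoute668`, so that this file is independent of it). -/
private lemma exists_translate_inv4_of_affineD (x : ZMod 167 → ℤ) {u : ZMod 167} (hu0 : u ≠ 0) (husq : u ^ 2 ≠ 1)
    (d : ZMod 167) (h : ∀ i, x (u * i + d) = x i) : ∃ δ : ZMod 167, ∀ i, translate x δ (4 * i) = translate x δ i := by
  haveI : Fact (Nat.Prime 167) := ⟨by norm_num⟩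
  set U : (ZMod 167)ˣ := Units.mk0 u hu0 with hU
  have hUu : (U : ZMod 167) = u := rfl
  have hU1 : (U : ZMod 167) ≠ 1 := by
    intro h1; apply husq; rw [← hUu, h1, one_pow]
  have htw : TwistedInvariant x U := twistedInvariant_of_affineD x U d (fun i => by rw [hUu]; exact h i)
  obtain ⟨δ, hδ⟩ := exists_translate_hInvariant_prime x U hU1 htw
  exact ⟨δ, inv4_of_hInvariant _ U (by rwa [hUu]) hδ⟩

/-- `χ'` is invariant under the non-zero squares (kernel evaluation). -/
lemma paley167_inv4 : ∀ i : ZMod 167, paley167 (4 * i) = paley167 i := by decide +kernel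

/-- translating both rows of a D-optimal pair independently preserves the pair condition. -/
lemma dOptPair_translate {n : ℕ} [NeZero n] {c d : ZMod n → ℤ} (hc : IsPM c) (hd : IsPM d)
    (hcd : ∀ s : ZMod n, s ≠ 0 → PAF c s + PAF d s = 2) (μ ν : ZMod n) :
    IsPM (translate c μ) ∧ IsPM (translate d ν) ∧ ∀ s : ZMod n, s ≠ 0 → PAF (translate c μ) s + PAF (translate d ν) s = 2 :=
  ⟨fun i => hc (i + μ), fun i => hd (i + ν), fun s hs => by rw [PAF_translate, PAF_translate]; exact hcd s hs⟩

/-- a constant `±1` row on `ZMod 167` has `|Σ| = 167`. -/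
private lemma natAbs_sum_const_167 (x : ZMod 167 → ℤ) (hx : IsPM x) (e : ZMod 167) (hconst : ∀ t, x t = x e) :
    (∑ i, x i).natAbs = 167 := by
  rw [Finset.sum_congr rfl (fun i _ => hconst i), Finset.sum_const, Finset.card_univ, ZMod.card]
  rcases hx e with h | h <;> rw [h] <;> simp

/-- **Census F8: no pair symmetry with `h² ≠ 1`.**  For a D-optimal pair `(x 0, x 1)` of length `167` there is no
`h : ZMod 167` with `h² ≠ 1`, permutation `π` of the two rows, signs `ε_k = ±1` and shifts `s_k` such that
`x_{πk}(h t + s_k) = ε_k x_k(t)` for all `k, t`.  (`h = 0`: the rows would be constant, `|Σ| = 167 ∉ {15, 21}`;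
`h ≠ 0`: square-invariant translates + `χ'` give a square-invariant GS quadruple, excluded by `no_gs_quad_qr167`.) -/
theorem dOptPair167_no_pairSymmetry (x : Fin 2 → ZMod 167 → ℤ) (hc : IsPM (x 0)) (hd : IsPM (x 1))
    (hcd : ∀ s : ZMod 167, s ≠ 0 → PAF (x 0) s + PAF (x 1) s = 2) {h : ZMod 167} (hsq : h ^ 2 ≠ 1)
    {π : Equiv.Perm (Fin 2)} {ε : Fin 2 → ℤ} (hε : ∀ k, ε k = 1 ∨ ε k = -1) {s : Fin 2 → ZMod 167}
    (hrel : ∀ k t, x (π k) (h * t + s k) = ε k * x k t) : False := by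
  haveI : Fact (Nat.Prime 167) := ⟨by norm_num⟩
  -- each row is affine-invariant under `h⁴`
  have hD := fun k => pairSymmetry_iterate4 hε hrel k
  by_cases h0 : h = 0
  · -- `h = 0`: row 0 is constant
    obtain ⟨D, hD0⟩ := hD 0
    have hconst : ∀ t, x 0 t = x 0 D := fun t => by rw [← hD0 t, h0]; simp
    have h167 := natAbs_sum_const_167 (x 0) hc D hconst
    rcases dOptPair167_rowsums (x 0) (x 1) hc hd hcd with ⟨h15, -⟩ | ⟨h21, -⟩ <;> omega
  · have husq : (h ^ 4) ^ 2 ≠ 1 := pow_four_sq_ne_one_167 h0 hsq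
    have hu0 : h ^ 4 ≠ 0 := pow_ne_zero 4 h0
    obtain ⟨D0, hD0⟩ := hD 0
    obtain ⟨D1, hD1⟩ := hD 1
    obtain ⟨μ, hμ⟩ := exists_translate_inv4_of_affineD (x 0) hu0 husq D0 hD0
    obtain ⟨ν, hν⟩ := exists_translate_inv4_of_affineD (x 1) hu0 husq D1 hD1
    obtain ⟨hc', hd', hcd'⟩ := dOptPair_translate hc hd hcd μ ν
    have hq := gsQuad_of_dOptPair167 _ _ hc' hd' hcd'
    exact no_gs167_qr_invariant _ _ _ _ hq paley167_inv4 paley167_inv4 hμ hν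

/-- **Corollary: no common multiplier `h` with `h² ≠ 1`** — the D-optimal pair `(c, d)` of length `167` is not invariant
(`c (h t) = c t`, `d (h t) = d t`) under any `h ∉ {1, −1}`; so the sub-family with multiplier group of order `83` or
`166` (row F8, 'C₈₃-symmetric (C, D)') is EMPTY. -/
theorem dOptPair167_no_multiplier (c d : ZMod 167 → ℤ) (hc : IsPM c) (hd : IsPM d)
    (hcd : ∀ s : ZMod 167, s ≠ 0 → PAF c s + PAF d s = 2) {h : ZMod 167} (hsq : h ^ 2 ≠ 1)
    (hch : ∀ t, c (h * t) = c t) (hdh : ∀ t, d (h * t) = d t) : False := by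
  refine dOptPair167_no_pairSymmetry ![c, d] hc hd hcd hsq (π := 1) (ε := fun _ => 1) (fun _ => Or.inl rfl)
    (s := fun _ => 0) (fun k t => ?_)
  fin_cases k
  · simpa using hch t
  · simpa using hdh t

/-- **the signed / shifted single-row forms** (no swap): no `c (h t + s) = ε c t` together with `d (h t + s') = ε' d t`,
`h² ≠ 1`. -/
theorem dOptPair167_no_signedAffine (c d : ZMod 167 → ℤ) (hc : IsPM c) (hd : IsPM d)
    (hcd : ∀ s : ZMod 167, s ≠ 0 → PAF c s + PAF d s = 2) {h : ZMod 167} (hsq : h ^ 2 ≠ 1) {ε ε' : ℤ}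
    (hε : ε = 1 ∨ ε = -1) (hε' : ε' = 1 ∨ ε' = -1) (sc sd : ZMod 167) (hch : ∀ t, c (h * t + sc) = ε * c t)
    (hdh : ∀ t, d (h * t + sd) = ε' * d t) : False := by
  refine dOptPair167_no_pairSymmetry ![c, d] hc hd hcd hsq (π := 1) (ε := ![ε, ε'])
    (fun k => by fin_cases k <;> assumption) (s := ![sc, sd]) (fun k t => ?_)
  fin_cases k
  · simpa using hch t
  · simpa using hdh t

/-- **the swapped form**: no `d (h t + s) = ε c t`, `c (h t + s') = ε' d t` with `h² ≠ 1` (the two rows exchanged by the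
symmetry; e.g. `d` a multiplier image of `c`). -/
theorem dOptPair167_no_swapAffine (c d : ZMod 167 → ℤ) (hc : IsPM c) (hd : IsPM d)
    (hcd : ∀ s : ZMod 167, s ≠ 0 → PAF c s + PAF d s = 2) {h : ZMod 167} (hsq : h ^ 2 ≠ 1) {ε ε' : ℤ}
    (hε : ε = 1 ∨ ε = -1) (hε' : ε' = 1 ∨ ε' = -1) (sc sd : ZMod 167) (hch : ∀ t, d (h * t + sc) = ε * c t)
    (hdh : ∀ t, c (h * t + sd) = ε' * d t) : False := by
  refine dOptPair167_no_pairSymmetry ![c, d] hc hd hcd hsq (π := Equiv.swap 0 1) (ε := ![ε, ε'])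
    (fun k => by fin_cases k <;> assumption) (s := ![sc, sd]) (fun k t => ?_)
  fin_cases k
  · simpa using hch t
  · simpa using hdh t

end census

end Summit.Ventures.DiscreteObjects.Hadamard
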